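import Literature.Claims.NS.Jennings2020
import Literature.Analysis.FluidPDE.ClassicalSolutionRescale
import Literature.Analysis.FluidPDE.NSLerayHopf
import Literature.Analysis.FluidPDE.KNSSLocalSmoothingHolds
import HarnessLib

/-!
# Solo salvage for claim C20 `Jennings2020` (cell `ns-claims`, D-0090): the `ν`-rescaling
# Step 10 (T11.1 (11.1)–(11.2) p.131–133), kernel-discharged

Claim skeleton: `Literature/Claims/NS/Jennings2020.lean` (G. Jennings, arXiv:2002.08270 v6, Thm 11.1
p.131; adjudicated row C20: first failing step `Step6b_JDilation`, (9.5)–(9.7) p.110, class false lemma,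
kernel `Summit.NavierStokesRegularity.NavierStokesRegularity.Theorems.Jennings2020.not_Step6b_JDilation`).

This file (seat `ns-claims-salvage-p2`, salvage lane of C20) discharges the LAST binder of the skeleton's
composition `claim_of_steps`, the on-path hypothesis `h10 : Step10_NuRescaling`:

* `step10_holds : Step10_NuRescaling` — T11.1 p.131: «the functions (11.1)
  `u^ν(x,t;u_o) := u^{ν=1}(xν⁻¹, tν⁻¹; u_o(xν))`, `p^ν(x,t;u_o) := p^{ν=1}(xν⁻¹, tν⁻¹; u_o(xν))` in
  which `ν` is `> 0` are a `C^∞` solution of the (1.1)_{ν,u_o} equations on `ℝ³ × [0,∞)` … and (11.2)».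
  As typed: from the `ν = 1` objects for the datum `u_o(xν)` (a global solution `U` of (7.1)_{γ=0},
  smooth on the closed half-space together with its pressure `pOf U`, solving Fefferman's (1)–(3) at
  `ν = 1`, with every slice of `U` and `pOf U` in `∩_m H^m` and the sup- and `L²`-bounds by the datum) to
  the conclusion for `(ν, u_o)` in the format of `jenningsSpec`.

The content is the classical covariance of the Navier–Stokes system under the affine space–time
substitution `(t, x) ↦ (t/ν, x/ν)` WITHOUT amplitude factor, which multiplies the viscosity by `ν`:
the case `α = 1`, `β = γ = ν⁻¹`, `t₀ = 0`, `x₀ = 0` of the tree's PROVED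
`Literature.Analysis.FluidPDE.IsClassicalNSSolutionOn.stRescale` (viscosity `α ν_old / γ = ν`, force
`0`), transported through the wave-0 bridge `Literature.Analysis.FluidPDE.isNavierStokesSolution_and_smooth_iff`;
plus the elementary invariances of the three `jenningsSpec.admissible` clauses under the spatial
homothety `x ↦ ν⁻¹ x`: `∩_m H^m` (chain rule in norm `norm_iteratedFDeriv_comp_smul_le` and the Haar
change of variables `Measure.map_addHaar_smul`), the sup-seminorm `linf` (a plain `iSup` over `ℝ³`,
reparametrised by a bijection) and `l2sq` (Haar: a common factor `ν³` on both sides of (11.2)).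
Original source of the step: Leray's similarity bookkeeping / «one can easily reduce to the `ν = 1` case
by a simple rescaling» (Tao 2013, Rem. 1.2) — not the claim.

Nothing in the verdict / locator / class / statements of C20 changes; this is a D-0026 discharge of a
TRUE step (DEBT-LEDGER 2026-08-27: `Step10_NuRescaling` OPEN). Solo lane
(`Theorems/SoloSalvage<Slug>….lean`, no item).

WHAT THIS IS NOT: not a claim about NS regularity or blow-up; not a claim about any author beyond the
typed locator.
-/

noncomputable section

open Set MeasureTheory Function
open scoped ENNReal ContDiff

-- The mandated landing namespace repeats the summit name by design (D-0017).
set_option linter.dupNamespace false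

namespace Summit.NavierStokesRegularity.NavierStokesRegularity.Theorems

namespace Jennings2020

open Literature.Claims.NS.Jennings2020 Literature.Analysis
open Literature.Analysis.FluidPDE hiding rescale

/-- Haar change of variables on `ℝ³` for lower integrals: `∫⁻ g(a • x) dx = |(a³)⁻¹| ∫⁻ g` for `a ≠ 0`
(Mathlib `Measure.map_addHaar_smul`; proof device). [folklore] -/
private theorem lintegral_comp_smul_R3' (g : E3 → ℝ≥0∞) {a : ℝ} (ha : a ≠ 0) :
    ∫⁻ x, g (a • x) = ENNReal.ofReal |(a ^ Module.finrank ℝ E3)⁻¹| * ∫⁻ x, g x := by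
  calc ∫⁻ x, g (a • x) = ∫⁻ y, g y ∂(Measure.map (a • ·) volume) :=
        (lintegral_map_equiv g (Homeomorph.smul (isUnit_iff_ne_zero.2 ha).unit).toMeasurableEquiv).symm
    _ = ENNReal.ofReal |(a ^ Module.finrank ℝ E3)⁻¹| * ∫⁻ x, g x := by
        rw [Measure.map_addHaar_smul volume ha, lintegral_smul_measure, smul_eq_mul]

/-- **`∩_m H^m` is invariant under spatial homotheties**: if every derivative of `v : ℝ³ → F` is in
`L²`, so is every derivative of `x ↦ v(a x)`, `a ≠ 0` — `‖Dⁿ[v(a·)](x)‖ ≤ |a|ⁿ ‖Dⁿv(ax)‖`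
(`norm_iteratedFDeriv_comp_smul_le`, no differentiability hypothesis) and `∫ g(ax) dx = |a|⁻³ ∫ g`.
The chain rule of p.109 l.7280–7283 / (11.1) p.131, for fields with values in any normed space
(velocity AND pressure slices). [cite: Jennings2020, (9.3) p.109, (11.1) p.131] -/
theorem isHInf_comp_smul {F : Type*} [NormedAddCommGroup F] [NormedSpace ℝ F] {v : E3 → F}
    (hv : IsHInf v) {a : ℝ} (ha : a ≠ 0) : IsHInf (fun x => v (a • x)) := by
  intro n
  have hpt : ∀ x : E3, ‖iteratedFDeriv ℝ n (fun y => v (a • y)) x‖ₑ ≤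
      ENNReal.ofReal (|a| ^ n) * ‖iteratedFDeriv ℝ n v (a • x)‖ₑ := by
    intro x
    rw [← ofReal_norm, ← ofReal_norm, ← ENNReal.ofReal_mul (by positivity)]
    exact ENNReal.ofReal_le_ofReal (norm_iteratedFDeriv_comp_smul_le v ha n x)
  calc ∫⁻ x, ‖iteratedFDeriv ℝ n (fun y => v (a • y)) x‖ₑ ^ 2
      ≤ ∫⁻ x, (ENNReal.ofReal (|a| ^ n) * ‖iteratedFDeriv ℝ n v (a • x)‖ₑ) ^ 2 :=
        lintegral_mono fun x => pow_le_pow_left' (hpt x) 2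
    _ = ENNReal.ofReal (|a| ^ n) ^ 2 * ∫⁻ x, ‖iteratedFDeriv ℝ n v (a • x)‖ₑ ^ 2 := by
        simp_rw [mul_pow]
        rw [lintegral_const_mul' _ _ (ENNReal.pow_ne_top ENNReal.ofReal_ne_top)]
    _ = ENNReal.ofReal (|a| ^ n) ^ 2 * (ENNReal.ofReal |(a ^ Module.finrank ℝ E3)⁻¹| *
          ∫⁻ x, ‖iteratedFDeriv ℝ n v x‖ₑ ^ 2) := by
        rw [lintegral_comp_smul_R3' (fun y => ‖iteratedFDeriv ℝ n v y‖ₑ ^ 2) ha]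
    _ < ⊤ := ENNReal.mul_lt_top (ENNReal.pow_lt_top ENNReal.ofReal_lt_top)
        (ENNReal.mul_lt_top ENNReal.ofReal_lt_top (hv n))

/-- The sup-seminorm `|v|_{L^∞} = sup_{x,k} |v_k(x)|` (p.3; the skeleton's `linf`, a plain supremum over
`ℝ³`) is invariant under the spatial homothety `x ↦ a x`, `a ≠ 0` (a bijection of `ℝ³`).
[cite: Jennings2020, §1 p.3, (11.2) p.131] -/
theorem linf_comp_smul (v : E3 → E3) {a : ℝ} (ha : a ≠ 0) :
    linf (fun x => v (a • x)) = linf v := by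
  unfold linf
  have hsurj : Function.Surjective (fun x : E3 => a • x) :=
    fun y => ⟨a⁻¹ • y, by simp [smul_smul, mul_inv_cancel₀ ha]⟩
  exact hsurj.iSup_comp (fun y => ⨆ k : Fin 3, ‖v y k‖ₑ)

/-- The `L²` mass `∫ |v|²` (the skeleton's `l2sq`) scales under `x ↦ a x`, `a ≠ 0`, by the Haar factor
`|a|⁻³`: `l2sq (v(a·)) = |(a³)⁻¹| · l2sq v`. [cite: Jennings2020, (1.5) p.95, (11.2) p.131] -/
theorem l2sq_comp_smul (v : E3 → E3) {a : ℝ} (ha : a ≠ 0) :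
    l2sq (fun x => v (a • x)) = ENNReal.ofReal |(a ^ Module.finrank ℝ E3)⁻¹| * l2sq v := by
  unfold l2sq
  exact lintegral_comp_smul_R3' (fun y => ‖v y‖ₑ ^ 2) ha

/-- The (11.1) rescaling `(t, x) ↦ U(t/ν, x/ν)` IS the tree's affine pull-back `stPull ν⁻¹ ν⁻¹ 0 0 U`
(`s ↦ 0 + ν⁻¹ s`, `y ↦ 0 + ν⁻¹ y`), for fields with values in any type. [cite: Jennings2020, (11.1) p.131] -/
theorem stPull_eq_rescale {F : Type*} (ν : ℝ) (W : ℝ → E3 → F) :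
    stPull ν⁻¹ ν⁻¹ 0 (0 : E3) W = rescale ν W := by
  funext s y
  simp [stPull_apply, rescale, div_eq_inv_mul]

/-- **Step 10 HOLDS (T11.1 (11.1)–(11.2) p.131–133 — the `ν`-rescaling).** Given `ν > 0`, a datum
`u_o ∈ ∩_m H^{m,df}`, and the `ν = 1` objects for the datum `u_o(xν)` — a global solution `U` of
(7.1)_{γ=0} (class `MolSol 0 (u_o(ν·)) ∞`), smooth on `ℝ³ × [0,∞)` together with its pressure `pOf U`,
every slice of `pOf U` in `∩_m H^m`, solving Fefferman's (1)–(3) at viscosity `1` with `f ≡ 0`, with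
`|U(t)|_{L^∞} ≤ |u_o(ν·)|_{L^∞}` and `|U(t)|²_{L²} ≤ |u_o(ν·)|²_{L²}` for `t ≥ 0` — the rescaled pair
`u^ν(x,t) = U(xν⁻¹, tν⁻¹)`, `p^ν(x,t) = (pOf U)(xν⁻¹, tν⁻¹)` is smooth on `ℝ³ × [0,∞)`, solves (1)–(3)
at viscosity `ν` from `u_o`, and satisfies the admissibility clauses of `jenningsSpec` (slices in
`∩_m H^m`, (11.2)). PDE part: `IsClassicalNSSolutionOn.stRescale` with `α = 1`, `β = γ = ν⁻¹`
(viscosity `1·1/ν⁻¹ = ν`, force `0`, time set `(ν⁻¹·)⁻¹[0,∞) = [0,∞)`) through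
`isNavierStokesSolution_and_smooth_iff`; datum `U(0)(ν⁻¹x) = u_o(ν ν⁻¹ x) = u_o(x)`; clauses by
`isHInf_comp_smul`, `linf_comp_smul`, `l2sq_comp_smul` at `a = ν⁻¹` and the hypotheses at time `t/ν`.
D-0026 discharge of a TRUE on-path step (binder `h10` of `claim_of_steps`); original source: the
scaling covariance of Navier–Stokes (Leray 1934 §20; Tao 2013 Rem. 1.2), not the claim.
[cite: Jennings2020, T11.1 (11.1)–(11.2) p.131–133] -/
theorem step10_holds : Step10_NuRescaling := by
  intro ν hν u₀ _hu₀ U hU hUs hPs hPH hNS hlinf hl2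
  have hν0 : ν ≠ 0 := hν.ne'
  have hνi : 0 < ν⁻¹ := inv_pos.2 hν
  have hνi0 : ν⁻¹ ≠ 0 := hνi.ne'
  -- the `ν = 1` solution as a classical solution on `[0, ∞)`
  obtain ⟨hcl, h0⟩ := isNavierStokesSolution_and_smooth_iff.mp ⟨hNS, hUs, hPs⟩
  -- Leray–type affine covariance with `α = 1`, `β = γ = ν⁻¹`
  have key := hcl.stRescale one_pos hνi (show ν⁻¹ = 1 * ν⁻¹ by rw [one_mul]) 0 (0 : E3)
  have hS : ((fun r : ℝ => 0 + ν⁻¹ * r) ⁻¹' Ici (0 : ℝ)) = Ici 0 := by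
    ext r
    simp only [mem_preimage, mem_Ici, zero_add]
    exact mul_nonneg_iff_of_pos_left hνi
  have hvisc : (1 : ℝ) * 1 / ν⁻¹ = ν := by rw [one_mul, one_div, inv_inv]
  have hf : ((1 : ℝ) ^ 2 * ν⁻¹) • stPull ν⁻¹ ν⁻¹ 0 (0 : E3) (0 : ℝ → E3 → E3) = 0 :=
    smul_stPull_zero _ _ _ _ _
  have hu : (1 : ℝ) • stPull ν⁻¹ ν⁻¹ 0 (0 : E3) U = rescale ν U := by
    rw [one_smul, stPull_eq_rescale]
  have hp : (1 : ℝ) ^ 2 • stPull ν⁻¹ ν⁻¹ 0 (0 : E3) (pOf U) = rescale ν (pOf U) := by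
    rw [one_pow, one_smul, stPull_eq_rescale]
  rw [hS, hvisc, hf, hu, hp] at key
  -- the datum: `U(0)(ν⁻¹ x) = u_o(ν ν⁻¹ x) = u_o(x)`
  have h0' : rescale ν U 0 = u₀ := by
    funext x
    have hinit : U 0 = dilData 1 ν u₀ := hU.init
    simp [rescale, hinit, dilData, smul_smul, mul_inv_cancel₀ hν0]
  obtain ⟨hns', hs', hps'⟩ := isNavierStokesSolution_and_smooth_iff.mpr ⟨key, h0'⟩
  refine ⟨hs', hps', hns', ?_, ?_, ?_⟩
  · -- slices of `u^ν`, `p^ν` in `∩_m H^m`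
    intro t ht
    have hst : t / ν ∈ strip ⊤ := ⟨div_nonneg ht hν.le, ENNReal.ofReal_lt_top⟩
    have h1 : IsHInf (U (t / ν)) := hU.hInf _ hst
    have h2 : IsHInf (pOf U (t / ν)) := hPH _ (div_nonneg ht hν.le)
    exact ⟨isHInf_comp_smul h1 hνi0, isHInf_comp_smul h2 hνi0⟩
  · -- (11.2), sup clause
    intro t ht
    show linf (fun x => U (t / ν) (ν⁻¹ • x)) ≤ linf (fun x => U (0 / ν) (ν⁻¹ • x))
    rw [linf_comp_smul _ hνi0, linf_comp_smul _ hνi0, zero_div, hU.init]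
    exact hlinf _ (div_nonneg ht hν.le)
  · -- (11.2), `L²` clause
    intro t ht
    show l2sq (fun x => U (t / ν) (ν⁻¹ • x)) ≤ l2sq (fun x => U (0 / ν) (ν⁻¹ • x))
    rw [l2sq_comp_smul _ hνi0, l2sq_comp_smul _ hνi0, zero_div, hU.init]
    exact mul_le_mul_right (hl2 _ (div_nonneg ht hν.le)) _

end Jennings2020

end Summit.NavierStokesRegularity.NavierStokesRegularity.Theorems

end

-- WHAT THIS IS NOT: not a claim about NS regularity or blow-up; not a claim about any author beyond the
-- typed locator.
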